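import Summits.SmoothPoincare4.SmoothPoincare4.Theorems.SymplecticOrigamiNoGenusTwoDoorStubTaubesCanonicalCurve
import Literature.Geometry.Symplectic.TaubesCanonicalClassSymplecticCurveFourProofs
import Literature.Geometry.Symplectic.HirzebruchSignatureAlmostComplexFour
import Literature.Geometry.Symplectic.TaubesCanonicalClassCurveUpToSign
import Literature.Geometry.Symplectic.ThomGysinComplementSurfaceFour
import HarnessLib

/-! # Stub `stub_taubesCanonicalCurve` (S1) of line `canonical-cap-filling` for crux `NoGenusTwoDoor`
(stmt-SmoothPoincare4-7842, route SymplecticOrigami) — CLOSED MODULO EXACTLY THE TWO PRINTED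
THEOREMS A DOOR NEEDS: Hirzebruch's `c₁² = 2χ + 3σ` and Li–Liu's `SW ⇒ Gr` at `b⁺ = 1`

**Statement (S1, Taubes canonical curve; the registered stub signature).** A DOOR — a closed
connected symplectic `4`-manifold `(N, s)` with `(rank H₁(N; ℤ), rank H₂(N; ℤ)) = (2, 1)` —
contains a smoothly embedded compact connected `s`-symplectic surface `B = b(S)` of genus `2`
(`rank H₁(S; ℤ) = 4`) with MERIDIAN INJECTIVITY `H₁(N ∖ B; ℤ) ↪ H₁(N; ℤ)`.

**What is proved here (lead reshape r3, 2026-08-17).** `stub_taubesCanonicalCurve_of_liLiu`: the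
registered signature from the two named facts of the tree that a door actually consumes —
* `Literature.Geometry.Symplectic.hirzebruch_firstChernClass_sq_eq_almostComplex_four`
  (Hirzebruch–Wu, `⟨c₁ ⌣ c₁, [N]⟩ = 2χ + 3σ` for a closed almost complex `4`-manifold with the
  orientation induced by `J`; McDuff–Salamon 2017, Rem. 4.1.10 eq. (4.1.7));
* `Literature.Geometry.Symplectic.liLiu1995_hasTaubesCurve_canonicalClass_of_bPlus_eq_one`
  (Li–Liu 1995/1999: `SW ⇒ Gr` for the canonical class when `b⁺ = 1`, `b₁ ≥ 1` and the rational
  cup product on `H¹` vanishes, sign-free form; McDuff–Salamon 2017, Thm. 13.3.22, Cor. 13.3.23).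
The sibling `stub_taubesCanonicalCurve_of_taubes` (p87978) took the umbrella fact
`taubes_canonicalClass_symplecticCurve_four`, whose tree reduction
(`taubes_canonicalClass_symplecticCurve_four_of_split`) also consumes Taubes 1995 Thm. A (1) for
`b⁺ ≥ 2` (`taubes1995_hasTaubesCurve_canonicalClass_of_two_le_bPlus`).  A door has `b₂ = 1`, hence
`b⁺ = 1` for its symplectic orientation (`sigPos_eq_one_and_sigNeg_eq_zero`), so the `b⁺ ≥ 2`
theorem is never invoked: this file re-runs the proof of p87978 POINTWISE at the door, producing the
Taubes package `(μ, K, b⁺ ≥ 1, K² = 2χ + 3σ, curve)` from the symplectic orientation of the tree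
(`exists_isSymplecticOrientationOf_one_le_sigPos`, unconditional), Hirzebruch
(`hirzebruch_symplectic_of_isComplexOrientationOf`), the cup lemma (`cupProduct_one_one_eq_zero_rat`,
p86619) and Li–Liu's curve (`HasTaubesCurve.conclusion`), and then repeating p87978's lattice /
one-component / adjunction / Thom–Gysin argument verbatim (Thom–Gysin discharged:
`thomGysin_complement_surface_four_holds`).

**Proof.** `b₂ = 1` and `b⁺ ≥ 1` give `(b⁺, b⁻) = (1, 0)`, `σ = 1`, `χ = -1`, so
`K² = 2χ + 3σ = 1`; in the coordinate `e : H²(N; ℤ)/T ≃ ℤ` of the odd unimodular rank-one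
lattice, `K ≡ k`, `k² = 1`.  Li–Liu's curve: components `Cᵢ = bᵢ(Sᵢ)`, multiplicities `mᵢ ≥ 1`,
`Σ mᵢ PD(Cᵢ) = K`, areas `A(Cᵢ) = nᵢ λ > 0`, adjunction `b₁(Sᵢ) − 2 = nᵢ² + k nᵢ`; all `nᵢ` have
one sign, so exactly ONE component, `m = 1`, `n = k = ±1`, `b₁(S) = 4`; and `g·S = ±1` for a lift
`g` of the generator kills the Thom–Gysin connecting map, so `H₁(N ∖ S) → H₁(N)` is injective.

Sources: Taubes, MRL 2 (1995) 221 (Thm. A (1), §3 (3.2), Prop. 4.2); Li–Liu, MRL 2 (1995) 453, §0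
and MRL 2 (1995) 797, Thm. 1.2, Cor. 1.3; Li–Liu, IMRN 1999 no. 7, Main Theorem; McDuff–Salamon
(2017) Rem. 4.1.10, §4.4, Thm. 13.3.22, Cor. 13.3.23; Bredon (1993) VI.11; Hatcher (2002) §3.3.
-/

noncomputable section
-- the prescribed namespace `Summit.<P>.<Sub>.…` duplicates `SmoothPoincare4` (P = Sub)
set_option linter.dupNamespace false
open scoped Manifold ContDiff Topology ContinuousMap
open Set Function TopologicalSpace
open Literature.Geometry.Kaehler (MForm IsSmoothForm IsClosedForm mextDeriv)
open Literature.AlgebraicTopology.SingularHomology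
open Literature.Topology.FourManifolds (singularHomologyZ)
open Literature.Geometry.Symplectic (exists_isSymplecticOrientationOf_one_le_sigPos)
open Literature.Geometry.Symplectic (hirzebruch_symplectic_of_isComplexOrientationOf)

namespace Summit.SmoothPoincare4.SmoothPoincare4.Theorems.NoGenusTwoDoor.CanonicalCapFilling

/-- **Taubes' canonical genus-2 curve of a door, modulo Hirzebruch and Li–Liu only.** Granted
Hirzebruch's `c₁² = 2χ + 3σ` for closed almost complex `4`-manifolds
(`hirzebruch_firstChernClass_sq_eq_almostComplex_four`) and Li–Liu's `SW ⇒ Gr` for the canonical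
class at `b⁺ = 1` (`liLiu1995_hasTaubesCurve_canonicalClass_of_bPlus_eq_one`), every door `(N, s)`
contains a smoothly embedded compact connected `s`-symplectic genus-`2` surface `B = b(S)`
(`rank H₁(S; ℤ) = 4`) with `H₁(N ∖ B; ℤ) → H₁(N; ℤ)` injective — the registered signature of
`stub_taubesCanonicalCurve`, verbatim, as conclusion; Taubes 1995 Thm. A (1) for `b⁺ ≥ 2` is not
used (a door has `b⁺ = 1`). Proof in the module docstring.
[cite: LiLiu1999, Main Theorem] [cite: Taubes1995, Thm. A (1) and Prop. 4.2]
[cite: McDuffSalamon2017, Rem. 4.1.10 eq. (4.1.7); Thm. 13.3.22; Cor. 13.3.23] -/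
theorem stub_taubesCanonicalCurve_of_liLiu :
    Literature.Geometry.Symplectic.hirzebruch_firstChernClass_sq_eq_almostComplex_four →
    Literature.Geometry.Symplectic.liLiu1995_hasTaubesCurve_canonicalClass_of_bPlus_eq_one →
    ∀ (N : Type) [TopologicalSpace N] [T2Space N] [SecondCountableTopology N] [CompactSpace N]
      [ConnectedSpace N] [ChartedSpace (EuclideanSpace ℝ (Fin 4)) N] [IsManifold (𝓡 4) ∞ N]
      (s : MForm (𝓡 4) N ℝ 2),
      IsSmoothForm s → IsClosedForm s →
      (∀ x (v : TangentSpace (𝓡 4) x), v ≠ 0 → ∃ w, s x ![v, w] ≠ 0) →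
      Module.finrank ℤ (singularHomologyZ N 1) = 2 → Module.finrank ℤ (singularHomologyZ N 2) = 1 →
      ∃ (S : Type) (_ : TopologicalSpace S) (_ : T2Space S) (_ : CompactSpace S)
        (_ : ConnectedSpace S) (_ : ChartedSpace (EuclideanSpace ℝ (Fin 2)) S)
        (_ : IsManifold (𝓡 2) ∞ S) (b : S → N),
        Module.finrank ℤ (singularHomologyZ S 1) = 4 ∧
        Manifold.IsSmoothEmbedding (𝓡 2) (𝓡 4) ∞ b ∧
        (∀ y (v : TangentSpace (𝓡 2) y), v ≠ 0 → ∃ w : TangentSpace (𝓡 2) y,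
          s (b y) ![mfderiv (𝓡 2) (𝓡 4) b y v, mfderiv (𝓡 2) (𝓡 4) b y w] ≠ 0) ∧
        Function.Injective (singularHomology.map ℤ ℤ
          (⟨Subtype.val, continuous_subtype_val⟩ : C(↥(Set.range b)ᶜ, N)) 1) := by
  intro hB hC₁ N _ _ _ _ _ _ _ s hs hcl hnd hb1 hb2
  have hb1' : Module.finrank ℤ (singularHomology ℤ ℤ N 1) = 2 := hb1
  have hb2' : Module.finrank ℤ (singularHomology ℤ ℤ N 2) = 1 := hb2
  -- the Taubes package of the door from Hirzebruch and Li–Liu: symplectic orientation `μ`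
  -- (`b⁺ ≥ 1`, hence `b⁺ = 1` at `b₂ = 1`), vanishing cup product on `H¹`, Li–Liu's curve in `K`
  obtain ⟨μ, hμ, hpos⟩ := exists_isSymplecticOrientationOf_one_le_sigPos s hs hcl hnd
  obtain ⟨hsp, -⟩ := sigPos_eq_one_and_sigNeg_eq_zero μ hpos hb2'
  have hcup : ∀ a b : singularCohomology ℚ ℚ N 1, cupProduct one_add_one_eq_two a b = 0 :=
    cupProduct_one_one_eq_zero_rat ⟨μ⟩ (finrank_rat_singularCohomology_two_eq_one hb2')
  obtain ⟨J, hJ, K, hK, hT⟩ := hC₁ N s hs hcl hnd μ hμ hsp (by omega) hcup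
  have hKK : cupPairing μ two_add_two_eq_four K K = 2 * relEuler ℤ ℤ N ∅ + 3 * μ.signature := by
    have h := hirzebruch_symplectic_of_isComplexOrientationOf hB N s hs hcl hnd μ hμ J hJ
    rcases hK with rfl | rfl
    · exact h
    · rw [J.firstChernClass_eq_neg_canonicalClass]
      simpa only [map_neg, LinearMap.neg_apply, neg_neg] using h
  -- the numerics of the door
  have hK1 : cupPairing μ two_add_two_eq_four K K = 1 := by
    rw [hKK, relEuler_eq_neg_one_of_door μ hb1' hb2', signature_eq_one_of_door μ hpos hb2']
    norm_num
  obtain ⟨r, S, _, _, _, _, _, b, hb, μS, m, A, hm, hsymp, -, hsum, hcomp⟩ := hT.conclusion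
  -- the rank-one lattice `H²(N; ℤ)/T = ℤ`, `Q(x, y) = e(x) e(y)`
  obtain ⟨e, he⟩ := exists_linearEquiv_intersectionForm_of_door μ hpos hb2'
  set π : singularCohomology ℤ ℤ N 2 →ₗ[ℤ] freeCohomology ℤ N 2 := freeCohomology.mk with hπ
  have hQ : ∀ x y : singularCohomology ℤ ℤ N 2,
      cupPairing μ two_add_two_eq_four x y = e (π x) * e (π y) := fun x y ↦ by
    rw [← intersectionForm_mk_mk]; exact he _ _
  set k : ℤ := e (π K) with hk
  have hk1 : k * k = 1 := by rw [hk, ← hQ K K, hK1]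
  -- Poincaré duality and the classes of the components
  set D := poincareDualityEquiv μ two_add_two_eq_four (poincare_duality μ two_add_two_eq_four)
    with hD
  set c : Fin r → singularHomology ℤ ℤ N 2 := fun i ↦
    singularHomology.map ℤ ℤ ⟨b i, (hb i).isEmbedding.continuous⟩ 2 (μS i).fundamentalClass
    with hc
  set σ : Fin r → singularCohomology ℤ ℤ N 2 := fun i ↦ D.symm (c i) with hσdef
  have hσ : ∀ i, poincareDualityMap μ two_add_two_eq_four (σ i) = c i := fun i ↦ by
    rw [← poincareDualityEquiv_apply μ two_add_two_eq_four (poincare_duality μ _), ← hD, hσdef]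
    exact D.apply_symm_apply (c i)
  set n : Fin r → ℤ := fun i ↦ e (π (σ i)) with hn
  -- `Σ mᵢ σᵢ = K`, hence `Σ mᵢ nᵢ = k`
  have hsumσ : ∑ i, (m i : ℤ) • σ i = K := by
    apply D.injective
    rw [map_sum, poincareDualityEquiv_apply, ← hsum]
    refine Finset.sum_congr rfl fun i _ ↦ ?_
    rw [map_zsmul, hσdef]
    exact congrArg _ (D.apply_symm_apply (c i))
  have hmn : ∑ i, (m i : ℤ) * n i = k := by
    have h := congrArg (fun x ↦ e (π x)) hsumσ
    simpa only [map_sum, map_zsmul, zsmul_eq_mul, Int.cast_id] using h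
  -- positivity: `A(cᵢ) = nᵢ · A'(g')`
  set A' : singularCohomology ℤ ℤ N 2 →ₗ[ℤ] ℝ := A.comp D.toLinearMap with hA'
  obtain ⟨g', hg'⟩ := freeCohomology.mk_surjective (R := ℤ) (X := N) (k := 2) (e.symm 1)
  have hkerπ : LinearMap.ker π ≤ Submodule.torsion ℤ (singularCohomology ℤ ℤ N 2) := by
    rw [hπ, freeCohomology.ker_mk]
  have hApos : ∀ i, 0 < (n i : ℝ) * A' g' := fun i ↦ by
    have h1 : A (c i) = A' (σ i) := by
      rw [hA', LinearMap.comp_apply, LinearEquiv.coe_coe, hσdef, LinearEquiv.apply_symm_apply]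
    have h2 := linearMap_apply_eq_of_linearEquiv A' π hkerπ e g' hg' (σ i)
    rw [zsmul_eq_mul] at h2
    have h3 := (hcomp i).1
    rw [h1, h2] at h3
    exact h3
  -- exactly one component, `m = 1`, `n = k`
  obtain ⟨hr1, hmn1⟩ := eq_one_of_sum_mul_eq_unit hm hApos hmn hk1
  subst hr1
  obtain ⟨-, hn0⟩ := hmn1 0
  have hnk : e (π (σ 0)) = k := hn0
  -- genus two
  have hadj := (hcomp 0).2 (σ 0) (hσ 0)
  rw [hQ, hQ, ← hk, hnk, hk1] at hadj
  have hb1S : Module.finrank ℤ (singularHomology ℤ ℤ (S 0) 1) = 4 := by omega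
  -- meridian injectivity from the Thom–Gysin sequence and `g·S = ±1`
  obtain ⟨-, δ, hrange, hkerδ⟩ :=
    Literature.Geometry.Symplectic.thomGysin_complement_surface_four_holds N μ (S 0) (μS 0) (b 0)
      (hb 0) (σ 0) (hσ 0)
  have hone : (1 : ℤ) ∈ LinearMap.range ((cupPairing μ two_add_two_eq_four).flip (σ 0)) := by
    have hg'1 : e (π g') = 1 := by rw [hg', LinearEquiv.apply_symm_apply]
    rcases Int.eq_one_or_neg_one_of_mul_eq_one hk1 with hk' | hk'
    · refine ⟨g', ?_⟩
      rw [LinearMap.flip_apply, hQ, hg'1, hnk, hk', mul_one]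
    · refine ⟨-g', ?_⟩
      rw [LinearMap.flip_apply, hQ, map_neg, map_neg, hg'1, hnk, hk']
      norm_num
  have htop : LinearMap.range ((cupPairing μ two_add_two_eq_four).flip (σ 0)) = ⊤ :=
    Ideal.eq_top_of_isUnit_mem _ hone isUnit_one
  have hδ : δ = 0 := LinearMap.ker_eq_top.mp (hkerδ.trans htop)
  have hkerι : LinearMap.ker (singularHomology.map ℤ ℤ
      (⟨Subtype.val, continuous_subtype_val⟩ : C(↥((Set.range (b 0))ᶜ), N)) 1).hom = ⊥ := by
    rw [← hrange, hδ, LinearMap.range_zero]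
  haveI : T2Space (S 0) := (hb 0).isEmbedding.t2Space
  exact ⟨S 0, inferInstance, inferInstance, inferInstance, inferInstance, inferInstance,
    inferInstance, b 0, hb1S, hb 0, hsymp 0, LinearMap.ker_eq_bot.mp hkerι⟩

end Summit.SmoothPoincare4.SmoothPoincare4.Theorems.NoGenusTwoDoor.CanonicalCapFilling
end
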